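import Literature.Computability.QuantumComplexity.PostBQPAmplification
import Literature.Computability.QuantumComplexity.CWrapAssembly
import Literature.Computability.QuantumComplexity.OracleSubstitution
import Literature.Computability.QuantumComplexity.BPPRelSubsetBQPRel
import Literature.Computability.Complexity.MajorityVoteWeighted
import Literature.Computability.Complexity.PostBPPHashLanguage
import HarnessLib

/-!
# BQP error reduction by majority vote over parallel copies (Bennett–Bernstein–Brassard–Vazirani 1997, Thm. 4.13)

Topic `Literature/Computability/QuantumComplexity`; the construction behind the discharge of the
named fact `Literature.Computability.Cryptography.BQP_eq_BQPWith` (`Cryptography/ClassBQP.lean`: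
for every constant `0 < ε < 1/2`, `BQPWith cliffordT ε = BQP`), assembled in
`Cryptography/ClassBQPAmplificationProofs.lean`. The printed proof (Bernstein–Vazirani 1997, §8.2,
Thm. 8.5, referring to Bennett–Bernstein–Brassard–Vazirani 1997, Thm. 4.13): "run `k` independent
copies of `M` and then take the vote of the `k` answers … the probability of seeing
`|x_{i_1}⟩ ⋯ |x_{i_k}⟩` such that the majority have the correct answer is the sum of
`|α_{i_1}|² ⋯ |α_{i_k}|²` such that the majority of `i_1, …, i_k` lie in `A`. But this is just like
taking the majority of `k` independent coin flips each with probability at least `2/3` of heads."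

This file composes two constructions of the tree instead of building a new circuit family:

* **the `K` parallel copies** are the amplified family `PostBQPAmp.family P` of
  `PostBQPAmplification.lean` (fan-out of the input, `K` verbatim copies of the given circuit on
  pairwise disjoint blocks, then a reversible stage 2 which, among other things, *negates* the
  answer wire `blk n j 0` of every copy in place; uniform by `PostBQPAmp.family_isUniform`). Here we
  read its *full* output kernel: after the basis permutation `perm2` the measured string carries at
  position `blk n j 0` the negated answer of copy `j` (`perm2_apply_ansW`), and the Born weights of
  the blocks form a product distribution (`PostBQPAmp.runOn_circ`, `sum_normSq_prodState_mul`) whose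
  one-block marginal of "answer wire reads `1`" is the acceptance probability of the given family
  (`sum_filter_blockState_wire0`);
* **the majority vote** is classical polynomial-time post-processing by the classical wrap
  `CWrap.family` of `CWrapAssembly.lean` (`CWrap.kernelProb_family_ge`) with the `FP` read-out
  function `maj P` ("at least `⌊K/2⌋ + 1` of the `K` answer positions read *accept*"), built from the
  bricks `bitAtFn`, `Plumb.polyFn`, `iteFn` (`rdBitF`, `thrF`, `maj_mem_FP`, `maj_boolPair`; the
  `Fin K`/`range K` count bridge is `PostBPPHash.card_filter_fin` of `Complexity/PostBPPHashLanguage.lean`);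
* **the coin-flip estimate** is the weighted Chebyshev bound `sum_majority_fail_mul_le` of
  `Complexity/MajorityVoteWeighted.lean` (error `≤ 1/(4Kη²)` for advantage `η`).

Main results: `PostBQPAmp.kernelProb_maj_ge` (the `K`-copy family followed by `maj` answers
correctly with probability `≥ 1 - 1/(4Kη²)`) and `exists_majority_amplified` (for every uniform
oracle-free Clifford+T family with advantage `η` there is a uniform oracle-free family with
two-sided error `≤ 1/(4Kη²)`).

## References

* C. H. Bennett, E. Bernstein, G. Brassard, U. Vazirani, *Strengths and weaknesses of quantum
  computing*, SIAM J. Comput. 26 (1997) 1510–1523, Thm. 4.13 and its proof (p. 1521 of the journal,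
  p. 12 of arXiv:quant-ph/9701001) [BennettBernsteinBrassardVazirani1997].
* E. Bernstein, U. Vazirani, *Quantum complexity theory*, SIAM J. Comput. 26 (1997) 1411–1473,
  §8.1 Def. 8.1, §8.2 Thm. 8.5 [BernsteinVazirani1997].
* M. A. Nielsen, I. L. Chuang, *Quantum Computation and Quantum Information*, CUP 2010, §2.2.5,
  §2.2.8, §3.2.5, §4.5.5 [NielsenChuang2010].
-/

noncomputable section

namespace Literature.Computability.QuantumComplexity

open _root_.Computability Complexity Cryptography RevSim RevMux Matrix Finset

namespace PostBQPAmp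

variable (P : Params)

/-! ### The read-out positions -/

/-- The position of the answer wire of copy `j` in the measured string, `blk n j 0`, as a
polynomial in the input length `n`: `(j+1)·(n + pF n + 2) + 1 + 3K`. [folklore] -/
def posPoly (j : ℕ) : Polynomial ℕ :=
  (Polynomial.C j + 1) * (Polynomial.X + P.pF + Polynomial.C 2) + Polynomial.C (1 + 3 * P.K)

/-- Value of `posPoly`: the answer wire of copy `j`. [folklore] -/
@[simp] theorem eval_posPoly (j n : ℕ) : (posPoly P j).eval n = blk P n j 0 := by
  simp [posPoly, blk, base, b]; ring

/-- `0 < b n`. [folklore] -/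
theorem b_pos (n : ℕ) : 0 < b P n := lt_of_lt_of_le Nat.zero_lt_two (two_le_b n)

/-! ### The read-out function: a threshold of bits at polynomial positions, in `FP` -/

/-- **The bit of the data at a polynomial position of the tag length**:
`rdBitF Q ⟨x, y⟩ = [y[Q(|x|)]]` (when `Q(|x|) < |y|`; junk otherwise). [Arora–Barak 2009, §1.3]
[cite: AroraBarak2009, §1.3] -/
def rdBitF (Q : Polynomial ℕ) : List Bool → List Bool :=
  bitAtFn ∘ fanoutFn (Plumb.polyFn Q ∘ Brick.fstF) Brick.sndF

/-- `rdBitF Q ∈ FP`. [cite: AroraBarak2009, §1.3] -/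
theorem rdBitF_mem_FP (Q : Polynomial ℕ) : rdBitF Q ∈ FP :=
  comp_mem_FP bitAtFn_mem_FP
    (fanoutFn_mem_FP (comp_mem_FP (Plumb.polyFn_mem_FP Q) Brick.fstF_mem_FP) Brick.sndF_mem_FP)

/-- Value of `rdBitF` on a pair, inside the data. [folklore] -/
theorem rdBitF_boolPair (Q : Polynomial ℕ) (x y : List Bool) (h : Q.eval x.length < y.length) :
    rdBitF Q (boolPair x y) = [y.getD (Q.eval x.length) false] := by
  simp only [rdBitF, Function.comp_apply, fanoutFn_apply, Brick.fstF_boolPair, Brick.sndF_boolPair,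
    Plumb.polyFn_apply]
  have hlen : (ones (Q.eval x.length)).length = Q.eval x.length := List.length_replicate ..
  rw [bitAtFn_boolPair_of_lt _ _ (by rw [hlen]; exact h)]
  simp only [hlen, List.getD_eq_getElem?_getD, List.getElem?_eq_getElem h, Option.getD_some]

/-- **The threshold read-out** `thrF pos t j`: on `⟨x, y⟩`, the bit `[t ≤ #{i < j | y[pos i (|x|)] = 0}]`
("at least `t` of the first `j` copies accept" — the answer wires are read negated), by the
recursion `thr (t+1) (j+1) = if bit j then thr (t+1) j else thr t j` on `iteFn`.
[cite: BennettBernsteinBrassardVazirani1997, Thm. 4.13 (proof; step 4: the majority of the k answers)] -/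
def thrF (pos : ℕ → Polynomial ℕ) : ℕ → ℕ → (List Bool → List Bool)
  | 0, _ => fun _ => [true]
  | _ + 1, 0 => fun _ => [false]
  | t + 1, j + 1 => iteFn (rdBitF (pos j)) (thrF pos (t + 1) j) (thrF pos t j)

/-- `thrF pos t j ∈ FP`. [cite: AroraBarak2009, §1.3] -/
theorem thrF_mem_FP (pos : ℕ → Polynomial ℕ) : ∀ t j : ℕ, thrF pos t j ∈ FP
  | 0, j => by simp only [thrF]; exact const_mem_FP _
  | t + 1, 0 => by simp only [thrF]; exact const_mem_FP _
  | t + 1, j + 1 => by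
    simp only [thrF]
    exact iteFn_mem_FP (rdBitF_mem_FP (pos j)) (thrF_mem_FP pos (t + 1) j) (thrF_mem_FP pos t j)

/-- The number of positions `i < j` at which the data reads `0`. [folklore] -/
def cntZero (pos : ℕ → Polynomial ℕ) (x y : List Bool) (j : ℕ) : ℕ :=
  ((Finset.range j).filter fun i => y.getD ((pos i).eval x.length) false = false).card

/-- `cntZero` at `j + 1`. [folklore] -/
theorem cntZero_succ (pos : ℕ → Polynomial ℕ) (x y : List Bool) (j : ℕ) :
    cntZero pos x y (j + 1) =
      cntZero pos x y j + (if y.getD ((pos j).eval x.length) false = false then 1 else 0) := by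
  unfold cntZero
  rw [Finset.range_add_one, Finset.filter_insert]
  split_ifs with h
  · rw [Finset.card_insert_of_notMem (fun h' => Finset.notMem_range_self (Finset.mem_filter.1 h').1)]
  · rw [Nat.add_zero]

/-- **Semantics of the threshold read-out** on a pair whose data covers the positions.
[cite: BennettBernsteinBrassardVazirani1997, Thm. 4.13 (proof; step 4: the majority of the k answers)] -/
theorem thrF_boolPair (pos : ℕ → Polynomial ℕ) (x y : List Bool) :
    ∀ t j : ℕ, (∀ i < j, (pos i).eval x.length < y.length) →
      thrF pos t j (boolPair x y) = [decide (t ≤ cntZero pos x y j)]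
  | 0, j, _ => by simp [thrF]
  | t + 1, 0, _ => by simp [thrF, cntZero]
  | t + 1, j + 1, h => by
    have hj : (pos j).eval x.length < y.length := h j (Nat.lt_succ_self j)
    have h' : ∀ i < j, (pos i).eval x.length < y.length := fun i hi => h i (Nat.lt_succ_of_lt hi)
    have hbit := rdBitF_boolPair (pos j) x y hj
    simp only [thrF]
    rw [cntZero_succ]
    cases hb : y.getD ((pos j).eval x.length) false
    · rw [hb] at hbit
      rw [iteFn_apply_false hbit, thrF_boolPair pos x y t j h', if_pos rfl]
      simp only [List.cons.injEq, and_true]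
      by_cases ht : t ≤ cntZero pos x y j
      · rw [decide_eq_true ht, decide_eq_true (by omega)]
      · rw [decide_eq_false ht, decide_eq_false (by omega)]
    · rw [hb] at hbit
      rw [iteFn_apply_true hbit, thrF_boolPair pos x y (t + 1) j h', if_neg (by simp)]
      simp

/-- **The majority read-out** of the `K`-copy family: accept iff at least `⌊K/2⌋ + 1` of the `K`
answer positions read *accept* (i.e. `0`, the answers being negated in the measured string).
[cite: BennettBernsteinBrassardVazirani1997, Thm. 4.13 (proof; step 4: the majority of the k answers)] -/
def maj : List Bool → List Bool := thrF (posPoly P) (P.K / 2 + 1) P.K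

/-- **The majority read-out is polynomial time.** [cite: BennettBernsteinBrassardVazirani1997, Thm. 4.13 (proof; steps 1 2 4 are easily computable functions)] -/
theorem maj_mem_FP : maj P ∈ FP := thrF_mem_FP _ _ _

/-- The number of copies `j < K` whose answer position reads *accept*. [folklore] -/
def accCount (x y : List Bool) : ℕ :=
  (univ.filter fun j : Fin P.K => y.getD (blk P x.length j 0) false = false).card

/-- **Semantics of the majority read-out** on a pair whose data covers the answer positions.
[cite: BennettBernsteinBrassardVazirani1997, Thm. 4.13 (proof; step 4: the majority of the k answers)] -/
theorem maj_boolPair (x y : List Bool) (h : ∀ j < P.K, blk P x.length j 0 < y.length) :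
    maj P (boolPair x y) = [decide (P.K / 2 + 1 ≤ accCount P x y)] := by
  unfold maj accCount
  rw [thrF_boolPair (posPoly P) x y _ _ (fun i hi => by rw [eval_posPoly]; exact h i hi), cntZero,
    PostBPPHash.card_filter_fin P.K (fun j => y.getD (blk P x.length j 0) false = false)]
  simp only [eval_posPoly]

/-! ### Reading the answer wires off the measured string of the `K`-copy family -/

variable {P}

/-- The answer wire of copy `j` as a wire of the register. [folklore] -/
def ansW (n : ℕ) (j : Fin P.K) : Fin (n + anc P n) := ⟨blk P n j 0, blk_fits j.isLt (b_pos P n)⟩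

/-- `ansW` is wire `0` of block `j`. [folklore] -/
theorem blockEmb_zero (n : ℕ) (j : Fin P.K) : blockEmb P n j ⟨0, b_pos P n⟩ = ansW n j := rfl

/-- **Stage 2 negates the answer wires**: after the basis permutation `perm2`, the answer wire
of copy `j` carries the negation of its content before stage 2 (the only operation of `prog2`
touching it is the layer of `NOT`s). [cite: NielsenChuang2010, §3.2.5 (reversible classical computation on basis states)] -/
theorem perm2_apply_ansW (n : ℕ) (z : QReg (n + anc P n)) (j : Fin P.K) :
    perm2 P n z (ansW n j) = !z (ansW n j) := by
  have hb : base P n ≤ blk P n j 0 := base_le_blk n j 0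
  have hA := aA_lt_base (P := P) n
  have hR := aR_lt_base (P := P) n
  have h2 : 2 ≤ b P n := two_le_b n
  have hbb := b_lt_base (P := P) n
  have hout : blk P n j 0 ∈ outs P n := mem_outs.2 ⟨j, j.isLt, rfl⟩
  rw [perm2_apply, clEval_prog2_eq]
  change clEval (swapOps [(aA P n, 0), (aR P n, 1)]) (stF P n (liftW z)) (blk P n j 0) = !z (ansW n j)
  rw [clEval_swapOps_of_forall_ne _ _ (fun p hp => by
    simp only [List.mem_cons, List.not_mem_nil, or_false] at hp
    rcases hp with rfl | rfl <;> constructor <;> simp only <;> omega)]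
  unfold stF
  rw [clEval_cons, clEval_nil, ClOp.eval_apply_of_ne _ _ (show blk P n j 0 ≠ aR P n by omega)]
  unfold stE
  rw [clEval_clChain_of_not_mem _ _ _ _ (blk_not_mem_cRs n j 0), stD_outs hout, stC_outs hout]
  congr 1
  exact liftW_val z (ansW n j)

/-- The measured string at the answer position of copy `j`. [folklore] -/
theorem getD_ofFn_perm2 (n : ℕ) (z : QReg (n + anc P n)) (j : Fin P.K) :
    (List.ofFn (perm2 P n z)).getD (blk P n j 0) false = !z (ansW n j) := by
  have hlt : blk P n j 0 < n + anc P n := (ansW n j).isLt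
  rw [List.getD_eq_getElem?_getD, List.getElem?_ofFn, dif_pos hlt, Option.getD_some]
  exact perm2_apply_ansW n z j

/-- **The accept count read off the measured string** is the number of copies whose answer
wire held `1` before stage 2. [folklore] -/
theorem accCount_ofFn_perm2 (x : List Bool) (z : QReg (x.length + anc P x.length)) :
    accCount P x (List.ofFn (perm2 P x.length z)) =
      (univ.filter fun j : Fin P.K => z (ansW x.length j) = true).card := by
  unfold accCount
  congr 1
  refine Finset.filter_congr fun j _ => ?_
  rw [getD_ofFn_perm2]
  cases z (ansW x.length j) <;> simp

/-! ### The output kernel of the `K`-copy family -/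

/-- **The output kernel of the `K`-copy family as a Born sum pulled back along stage 2.**
[cite: NielsenChuang2010, §2.2.5 (Born rule) and §3.2.5] -/
theorem kernelProb_family_eq (x : List Bool) (E : Set (List Bool)) [DecidablePred (· ∈ E)] :
    (family P).kernelProb 0 x E = ∑ z : QReg (x.length + anc P x.length),
      if List.ofFn (perm2 P x.length z) ∈ E then
        ‖prodState (blockEmb P x.length) (fun _ => blockState P x) (W1 P x) z‖ ^ 2 else 0 := by
  classical
  change ((((circ P x.length).outputPMF 0 x.get).map List.ofFn).toOuterMeasure E).toReal = _
  rw [toReal_outputPMF_map_ofFn, runOn_circ]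
  rw [sum_ite_normSq_mulVec_of_perm (perm2 P x.length) (toMatrix_stage2_mulVec_basisState 0) _
    (fun y => List.ofFn y ∈ E)]

/-- **Every block state is a unit vector** (Clifford+T circuits are unitary).
[cite: NielsenChuang2010, §2.2.5 (normalisation)] -/
theorem sum_normSq_blockState (x : List Bool) : ∑ v, ‖blockState P x v‖ ^ 2 = 1 := by
  have h := normSq_mulVec_of_mem_unitaryGroup
    (QCircuit.toMatrix_mem_unitaryGroup_holds cliffordT_isUnitary_holds 0 (Cpad P x.length))
    (basisState (padBlock P x))
  rw [normSq_basisState] at h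
  exact h

/-- **The one-block marginal of "the answer wire reads `1`" is the acceptance probability of the
given family** (also on the empty register, where both vanish).
[cite: NielsenChuang2010, §2.2.8 (measurement of one register of a product state)] -/
theorem sum_filter_blockState_wire0 (x : List Bool) :
    (∑ v ∈ univ.filter (fun v : QReg (b P x.length) => v ⟨0, b_pos P x.length⟩ = true),
      ‖blockState P x v‖ ^ 2) = P.F.acceptProbOn 0 x := by
  classical
  rw [Finset.sum_filter]
  by_cases hk : 0 < x.length + P.F.ancillas x.length
  · -- the answer wire lies inside the copy
    have hT : ∀ v : QReg (b P x.length), (v ⟨0, b_pos P x.length⟩ = true) ↔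
        ((v ∘ Fin.castLEEmb (copy_fits x.length)) ⟨0, hk⟩ = true) := fun v => Iff.rfl
    simp only [blockState, Cpad, toMatrix_mapWires]
    rw [show (∑ v : QReg (b P x.length), if v ⟨0, b_pos P x.length⟩ = true then
        ‖(placeGate (Fin.castLEEmb (copy_fits x.length)) ((P.F.circ x.length).toMatrix 0) *ᵥ
          basisState (padBlock P x)) v‖ ^ 2 else 0) = ∑ v : QReg (b P x.length),
        if ((v ∘ Fin.castLEEmb (copy_fits x.length)) ⟨0, hk⟩ = true) then
          ‖(placeGate (Fin.castLEEmb (copy_fits x.length)) ((P.F.circ x.length).toMatrix 0) *ᵥ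
            basisState (padBlock P x)) v‖ ^ 2 else 0
      from Finset.sum_congr rfl fun v _ => by simp only [hT]]
    rw [sum_normSq_placeGate_castLE (copy_fits x.length) ((P.F.circ x.length).toMatrix 0) (padBlock P x)
      (fun u : QReg (x.length + P.F.ancillas x.length) => u ⟨0, hk⟩ = true), padBlock_comp_castLE]
    unfold QCircuitFamily.acceptProbOn QCircuit.acceptProb
    refine Finset.sum_congr rfl fun u _ => ?_
    simp only [hk, dif_pos, QCircuit.runOn, mulVec_basisState]
  · -- the empty register: both sides vanish
    have hk0 : x.length + P.F.ancillas x.length = 0 := by omega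
    have hx : x.length = 0 := by omega
    unfold QCircuitFamily.acceptProbOn QCircuit.acceptProb
    trans (0 : ℝ)
    · refine Finset.sum_eq_zero fun v _ => ?_
      split_ifs with hv
      · simp only [blockState, Cpad, toMatrix_mapWires]
        rw [placeGate_castLE_mulVec_basisState (copy_fits x.length) _ (padBlock P x)
          (fun i hi => padBlock_of_le i (by omega)), if_neg (fun h => ?_)]
        · simp
        · have := h ⟨0, b_pos P x.length⟩ (by simp [hk0])
          rw [hv] at this
          exact Bool.noConfusion this
      · rfl
    · symm
      exact Finset.sum_eq_zero fun u _ => by rw [dif_neg hk]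

/-- The one-block marginal of "the answer wire reads `0`" is the rejection probability.
[cite: NielsenChuang2010, §2.2.8 (measurement of one register of a product state)] -/
theorem sum_filter_blockState_wire0_false (x : List Bool) :
    (∑ v ∈ univ.filter (fun v : QReg (b P x.length) => v ⟨0, b_pos P x.length⟩ = false),
      ‖blockState P x v‖ ^ 2) = 1 - P.F.acceptProbOn 0 x := by
  classical
  rw [← sum_filter_blockState_wire0, ← sum_normSq_blockState (P := P) x, eq_sub_iff_add_eq,
    ← Finset.sum_filter_add_sum_filter_not univ (fun v : QReg (b P x.length) => v ⟨0, b_pos P x.length⟩ = false)]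
  congr 1
  exact Finset.sum_congr (Finset.filter_congr fun v _ => by simp) fun _ _ => rfl

/-! ### The majority is right with probability `≥ 1 - 1/(4Kη²)` -/

/-- Counting: a strict majority of good copies decides the threshold. [folklore] -/
theorem decide_threshold_of_majority (c : Bool) {K : ℕ} (s : Fin K → Bool)
    (h : ¬ 2 * (univ.filter fun j => s j = c).card ≤ K) :
    decide (K / 2 + 1 ≤ (univ.filter fun j => s j = true).card) = c := by
  have hsum := Finset.card_filter_add_card_filter_not (s := (univ : Finset (Fin K)))
    (fun j => s j = true)
  simp only [Finset.card_univ, Fintype.card_fin] at hsum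
  have hneg : (univ.filter fun j => ¬ s j = true).card = (univ.filter fun j => s j = false).card :=
    congrArg Finset.card (Finset.filter_congr fun j _ => by simp)
  cases c
  · rw [hneg] at hsum
    exact decide_eq_false (by omega)
  · exact decide_eq_true (by omega)

/-- **The `K`-copy family followed by the majority read-out answers `c` with probability at least
`1 - 1/(4Kη²)`** whenever one copy answers `c` with probability at least `1/2 + η`: the Born weights
of the blocks form a product distribution, and "the majority of `k` independent coin flips each with
probability at least `1/2 + η` of heads" fails with probability `≤ 1/(4kη²)` (Chebyshev).
[cite: BennettBernsteinBrassardVazirani1997, Thm. 4.13 (proof)] -/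
theorem kernelProb_maj_ge (x : List Bool) (c : Bool) {η : ℝ} (hη : 0 < η)
    (hgood : 1 / 2 + η ≤ ∑ v ∈ univ.filter (fun v : QReg (b P x.length) => v ⟨0, b_pos P x.length⟩ = c),
      ‖blockState P x v‖ ^ 2) :
    1 - 1 / (4 * P.K * η ^ 2) ≤ (family P).kernelProb 0 x {y | maj P (boolPair x y) = [c]} := by
  classical
  rw [kernelProb_family_eq]
  set w : QReg (b P x.length) → ℝ := fun v => ‖blockState P x v‖ ^ 2 with hw
  set good : QReg (b P x.length) → Prop := fun v => v ⟨0, b_pos P x.length⟩ = c with hgooddef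
  set fail : (Fin P.K → QReg (b P x.length)) → Prop :=
    fun y => 2 * (univ.filter fun j => good (y j)).card ≤ P.K with hfail
  have hw0 : ∀ v, 0 ≤ w v := fun v => by positivity
  have hw1 : ∑ v, w v = 1 := sum_normSq_blockState x
  -- the weighted Chebyshev bound for the product weights
  have hcheb := sum_majority_fail_mul_le w hw0 hw1 good P.hK hη hgood
  have hpos : (0 : ℝ) < 4 * P.K * η ^ 2 := by have := P.hK; positivity
  have hfailSum : (∑ y ∈ univ.filter fail, ∏ j, w (y j)) ≤ 1 / (4 * P.K * η ^ 2) := by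
    rw [le_div_iff₀ hpos]; exact hcheb
  -- total product weight `1`
  have htot : (∑ y : Fin P.K → QReg (b P x.length), ∏ j, w (y j)) = 1 := by
    have e := Finset.prod_univ_sum (fun _ : Fin P.K => (univ : Finset (QReg (b P x.length)))) (fun _ v => w v)
    simp only [Fintype.piFinset_univ] at e
    rw [← e, hw1, Finset.prod_const_one]
  -- termwise comparison after the pull-back along stage 2
  have hterm : ∀ z : QReg (x.length + anc P x.length),
      ‖prodState (blockEmb P x.length) (fun _ => blockState P x) (W1 P x) z‖ ^ 2 *
          (1 - if fail (fun j => z ∘ blockEmb P x.length j) then 1 else 0) ≤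
        (if List.ofFn (perm2 P x.length z) ∈ {y | maj P (boolPair x y) = [c]} then
          ‖prodState (blockEmb P x.length) (fun _ => blockState P x) (W1 P x) z‖ ^ 2 else 0) := by
    intro z
    by_cases hf : fail (fun j => z ∘ blockEmb P x.length j)
    · rw [if_pos hf, sub_self, mul_zero]
      split_ifs <;> positivity
    · rw [if_neg hf, sub_zero, mul_one, if_pos]
      rw [Set.mem_setOf_eq, maj_boolPair P x _ (fun j hj => by
        rw [List.length_ofFn]; exact blk_fits hj (b_pos P x.length)), accCount_ofFn_perm2]
      congr 1
      refine decide_threshold_of_majority c (fun j => z (ansW x.length j)) ?_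
      simpa only [hfail, hgooddef, Function.comp_apply, blockEmb_zero] using hf
  calc 1 - 1 / (4 * P.K * η ^ 2)
      ≤ 1 - ∑ y ∈ univ.filter fail, ∏ j, w (y j) := by linarith
    _ = ∑ y : Fin P.K → QReg (b P x.length), (∏ j, w (y j)) * (1 - if fail y then 1 else 0) := by
        have e : ∀ y : Fin P.K → QReg (b P x.length), (∏ j, w (y j)) * (1 - if fail y then 1 else 0) =
            (∏ j, w (y j)) - (if fail y then ∏ j, w (y j) else 0) := fun y => by
          split_ifs <;> ring
        simp only [e, Finset.sum_sub_distrib, htot, Finset.sum_filter]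
    _ = ∑ z : QReg (x.length + anc P x.length),
          ‖prodState (blockEmb P x.length) (fun _ => blockState P x) (W1 P x) z‖ ^ 2 *
            (1 - if fail (fun j => z ∘ blockEmb P x.length j) then 1 else 0) :=
        (sum_normSq_prodState_mul blockDisjoint (fun _ => blockState P x) (W1 P x)
          (fun y => 1 - if fail y then 1 else 0)).symm
    _ ≤ _ := Finset.sum_le_sum fun z _ => hterm z

/-- **Yes-instances**: if one copy accepts with probability `≥ 1/2 + η`, the majority read-out says
`accept` with probability `≥ 1 - 1/(4Kη²)`. [cite: BennettBernsteinBrassardVazirani1997, Thm. 4.13 (proof)] -/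
theorem kernelProb_maj_true_ge (x : List Bool) {η : ℝ} (hη : 0 < η) (hx : 1 / 2 + η ≤ P.F.acceptProbOn 0 x) :
    1 - 1 / (4 * P.K * η ^ 2) ≤ (family P).kernelProb 0 x {y | maj P (boolPair x y) = [true]} :=
  kernelProb_maj_ge x true hη (by rw [sum_filter_blockState_wire0]; exact hx)

/-- **No-instances**: if one copy accepts with probability `≤ 1/2 - η`, the majority read-out says
`reject` with probability `≥ 1 - 1/(4Kη²)`. [cite: BennettBernsteinBrassardVazirani1997, Thm. 4.13 (proof)] -/
theorem kernelProb_maj_false_ge (x : List Bool) {η : ℝ} (hη : 0 < η) (hx : P.F.acceptProbOn 0 x ≤ 1 / 2 - η) :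
    1 - 1 / (4 * P.K * η ^ 2) ≤ (family P).kernelProb 0 x {y | maj P (boolPair x y) = [false]} :=
  kernelProb_maj_ge x false hη (by rw [sum_filter_blockState_wire0_false]; linarith)

end PostBQPAmp

/-! ### The amplified family: `K` copies, then the classical majority -/

/-- **Majority-vote amplification of a uniform quantum circuit family** (Bennett–Bernstein–
Brassard–Vazirani 1997, Thm. 4.13, in the tree's uniform Clifford+T circuit model): for every
polynomial-time uniform, oracle-free family `F`, every `K ≥ 1` and `η > 0` there is a
polynomial-time uniform, oracle-free family `F'` — `K` parallel copies of `F` (`PostBQPAmp.family`)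
followed by the classical polynomial-time majority read-out (`CWrap.family` with `PostBQPAmp.maj`) —
which accepts with probability `≥ 1 - 1/(4Kη²)` every input that `F` accepts with probability
`≥ 1/2 + η`, and with probability `≤ 1/(4Kη²)` every input that `F` accepts with probability
`≤ 1/2 - η`. [cite: BennettBernsteinBrassardVazirani1997, Thm. 4.13] -/
theorem exists_majority_amplified {F : QCircuitFamily cliffordT} (hF : F.IsOracleFree) (hU : F.IsUniform)
    {K : ℕ} (hK : 0 < K) {η : ℝ} (hη : 0 < η) :
    ∃ F' : QCircuitFamily cliffordT, F'.IsOracleFree ∧ F'.IsUniform ∧ ∀ x : List Bool,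
      (1 / 2 + η ≤ F.acceptProbOn 0 x → 1 - 1 / (4 * K * η ^ 2) ≤ F'.acceptProbOn 0 x) ∧
      (F.acceptProbOn 0 x ≤ 1 / 2 - η → F'.acceptProbOn 0 x ≤ 1 / (4 * K * η ^ 2)) := by
  obtain ⟨pF, hpF⟩ := QCircuitFamily.IsUniform.isPolySize' hU
  let P₀ : PostBQPAmp.Params := ⟨F, pF, fun n => (hpF n).2, K, hK⟩
  have hRfree : (PostBQPAmp.family P₀).IsOracleFree := PostBQPAmp.family_isOracleFree P₀ hF
  have hRU : (PostBQPAmp.family P₀).IsUniform := PostBQPAmp.family_isUniform P₀ hU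
  obtain ⟨P, hPh, hPg, hPF⟩ := CWrap.exists_params (PolyTimeComputable.id _) (PostBQPAmp.maj_mem_FP P₀) hRU
  refine ⟨CWrap.family P, CWrap.family_isOracleFree P (hPF ▸ hRfree), CWrap.family_isUniform P (hPF ▸ hRU),
    fun x => ⟨fun hx => ?_, fun hx => ?_⟩⟩
  · -- yes-instances: the wrapped family writes `true` first with probability `≥ 1 - 1/(4Kη²)`
    have hker := CWrap.kernelProb_family_ge P x (fun _ => {y | PostBQPAmp.maj P₀ (boolPair x y) = [true]})
    rw [hPh, hPg, hPF] at hker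
    have hsub : {z | ∃ y ∈ ({y | PostBQPAmp.maj P₀ (boolPair x y) = [true]} : Set (List Bool)),
        PostBQPAmp.maj P₀ (boolPair x y) <+: z} ⊆ {z | [true] <+: z} := by
      rintro z ⟨y, hy, hz⟩
      rw [Set.mem_setOf_eq] at hy
      rw [hy] at hz
      exact hz
    rw [← kernelProb_prefix_true_eq_acceptProbOn]
    exact ((PostBQPAmp.kernelProb_maj_true_ge (P := P₀) x hη hx).trans hker).trans
      ((CWrap.family P).kernelProb_mono 0 x hsub)
  · -- no-instances: the wrapped family writes `false` first with probability `≥ 1 - 1/(4Kη²)`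
    have hker := CWrap.kernelProb_family_ge P x (fun _ => {y | PostBQPAmp.maj P₀ (boolPair x y) = [false]})
    rw [hPh, hPg, hPF] at hker
    have hsub : {z | ∃ y ∈ ({y | PostBQPAmp.maj P₀ (boolPair x y) = [false]} : Set (List Bool)),
        PostBQPAmp.maj P₀ (boolPair x y) <+: z} ⊆ {z | [false] <+: z} := by
      rintro z ⟨y, hy, hz⟩
      rw [Set.mem_setOf_eq] at hy
      rw [hy] at hz
      exact hz
    have h1 := ((PostBQPAmp.kernelProb_maj_false_ge (P := P₀) x hη hx).trans hker).trans
      ((CWrap.family P).kernelProb_mono 0 x hsub)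
    have h2 := kernelProb_add_kernelProb_le_one (CWrap.family P) 0 x disjoint_prefix_true_false
    rw [kernelProb_prefix_true_eq_acceptProbOn] at h2
    linarith

end Literature.Computability.QuantumComplexity

end
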